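import Summits.QuantumFields.YangMills.Theorems.FluctuationComparisonRegPrIntLOrganTangentModeSectionTools
import Summits.QuantumFields.YangMills.Theorems.FluctuationComparisonRegPrIntLOrganTangentTriangularChart
import Summits.QuantumFields.YangMills.Theorems.BalabanUVNodesN09DomAltThresholdNull
import Literature.MathematicalPhysics.QuantumFieldTheory.Balaban1983to89.T4TriangularFibredChart
import Literature.MathematicalPhysics.QuantumFieldTheory.Balaban1983to89.T3UnitScaleTilt
import Literature.MathematicalPhysics.QuantumFieldTheory.Balaban1983to89.T3UnitLawDensityEML
import Literature.MathematicalPhysics.QuantumFieldTheory.Balaban1983to89.T3OrbitAverage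
import HarnessLib

/-!
# Crux `FluctuationComparisonRegPrIntL` (stmt-QuantumFields-20520, rung R3), PATH-B organ O1 v17.2, LINE g26-1 «mode_section» v1.1 (ideator ym-r3-idea-1 g26),
# row MODE∘ `ModeSectionCan` — THE KNIT «MODE∘ ⟸ UNIQ-MAX∘ ∧ the per-bond chart letters of the (A)-road»: CONTINUITY of the fibre-mode section is
# kernel bookkeeping once the mode is UNIQUE; what remains of MODE∘ is the one-well letter

LEAD-20520 width seat ym-ust-20520-w3 g23 (cell ym3-torus), `--supports stmt-QuantumFields-20520` (helper).  THEOREMS ONLY, def-free.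

THE CUT.  MODE∘ (`Lines/mode_section.lean` v1.1, row 1 of LINE g26-1; its card's why-fail: «a second well inside the window … orbit bifurcation») asks,
in O1's frame from a height, for a `W`-CONTINUOUS section `Us` of `descend` over the coarse window `W = {PlaqSmall θ_j}`, valued in the HALF fine window,
with `ρ′_{j+1} U ≤ ρ′_{j+1} (Us V)` for every `θ_{j+1}`-small `U` over `V`.  ★★`modeSection_of_uniqueFibreMax` proves exactly this conclusion (per height,
frame binders displayed) from:
* UNIQ-MAX∘ (the LETTER): for every window datum `V` the restriction of `ρ′_{j+1}` to the `θ_{j+1}`-small part of the fibre `{descend = V}` attains its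
  maximum at a UNIQUE point, which is `θ_{j+1}∕2`-small — existence∕location∕uniqueness of the fibre mode, pointwise in `V`, NO continuity asked;
* the per-bond chart letters of the (A)-road at the FULL window radius `a := θ_{j+1}` — `T c U` open, `θ c U` continuous on `T c U`, the right-inverse
  identity `hright`, and (SOL) «small fields sit in their own charts» (`descend U c ∈ T c U`, `θ c U (descend U c) = U (β c)`) — the clauses of
  ✓`…OrganTangentOneBondData.oneBondData` (w5 g21), whose numeric side conditions hold at `a = θ_{j+1}` from a height exactly as at `a = (24∕25)θ_{j+1}`;
  they make `V′ ↦ extend β (c ↦ θ c U (V′ c)) U` a local continuous section of `descend` through every small fine field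
  (✓`T4TriangularFibredChart.apply_triChart_eq_of_forall_mem`, ✓`…OrganTangentTriangularChart.isLocal_descend ∕ injective_private ∕ continuous_extend_left`);
* `ContinuousOn (descend F ℰp j) {PlaqSmall θ_{j+1}}` (✓`continuousOn_blockAvg_expMeanLogSU` + `fieldShift`, from a height) and the frame's
  `ContinuousOn ρ′_{j+1} {PlaqSmall θ_{j+1}}`;
through the Berge-type theorem ✓`…OrganTangentModeSectionTools.continuousOn_of_unique_fibreMax` (compact fine fields, Hausdorff coarse fields, closed half-shell).

HONEST FRAMING: topology over hypothesis letters; nothing of Bałaban's analysis is asserted or proved; UNIQ-MAX∘ is a HYPOTHESIS SHAPE (= [Balaban1985UV3]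
(42)–(44) «regular minimiser» territory for the reference tower's fibre law, plus one-well-ness), not proved; MODE∘ (as a row), TRM∘ (under re-typing,
FL-17), LAP∘, LIN∘, VER∘, JEN∘, O1, crux 20520, `YM3TorusSU2` are NOT proved; registry `Lines/semiclassical_s2beta.lean` v11.4 (★★OWNER RULING №36) untouched
and nothing here is registered; rung R3 = SU(2) YM₃ on T³ — NOT d = 4, NOT infinite volume, NOT a mass gap, NOT Clay; the Yang–Mills mass gap is NOT
proved by any of this.
-/

set_option autoImplicit false

noncomputable section

namespace Summit.QuantumFields.YangMills.Theorems.OrganTangentModeSectionKnit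

open Filter Topology Set Function
open Literature.MathematicalPhysics.QuantumFieldTheory.Balaban1983to89
open T3ContinuumYM3Torus T3NestedUnitLaws T3UnitLawDensityEML T3UnitScaleTilt T3LevelShift
open Literature.MathematicalPhysics.QuantumFieldTheory.Balaban1983to89.T4TriangularPushforward (IsLocal)
open Literature.MathematicalPhysics.QuantumFieldTheory.Balaban1983to89.BlockAveragingHaarAC (centralBond)
open Literature.MathematicalPhysics.QuantumFieldTheory.Balaban1983to89.T3OrbitAverage
open Summit.QuantumFields.YangMills.Theorems.OrganTangentFibreMeanTools (continuous_dist1_plaqHol isClosed_setOf_dist1_le)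
open Summit.QuantumFields.YangMills.Theorems.OrganTangentTriangularChart (isLocal_descend injective_private continuous_extend_left)
open Summit.QuantumFields.YangMills.Theorems.OrganTangentModeSectionTools
open Summit.QuantumFields.YangMills.BalabanUVNodes.N09DomAltThresholdNull (isOpen_setOf_plaqSmall_SU)

/-- ★★ **MODE∘ FROM A UNIQUE FIBRE MAXIMISER + THE PER-BOND CHART LETTERS.**  At heights `j, j+1` (`θ′ = θ_{j+1} > 0`): a density `r′` continuous on
the fine window `{PlaqSmall θ′}`; per coarse bond `c` (private fine bond `β c := centralBond (bondShift (sitesPerDir_descend F j 0) c)`) the one-bond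
data `T c U` (open), `θ c U` (continuous on `T c U`, right inverse: `descend (update U (β c) (θ c U v)) c = v` on `T c U`) and (SOL) at the FULL window
radius (`PlaqSmall θ′ U → descend U c ∈ T c U ∧ θ c U (descend U c) = U (β c)`) — the letters of ✓`…OrganTangentOneBondData.oneBondData` at `a := θ′`;
and the letter UNIQ-MAX∘: for every window datum `V`, `r′` restricted to the `θ′`-small part of the fibre `{descend = V}` attains its maximum at a UNIQUE
point, which is `θ′∕2`-small.  THEN MODE∘'s conclusion at height `j` holds: a `W`-CONTINUOUS section `Us` of `descend` over the coarse window, valued in the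
half window, maximising `r′` on every small-field fibre (Berge-type continuity ✓`…ModeSectionTools.continuousOn_of_unique_fibreMax`; the local sections
of `descend` through every small fine field are the triangular chart `V′ ↦ extend β (c ↦ θ c U (V′ c)) U`, ✓`T4TriangularFibredChart.apply_triChart_eq_of_forall_mem`).
[cite: Balaban1985UV3, (42)-(44) p.266; Balaban1987RG1, (0.4) p.253 and (2.4) p.266] -/
theorem modeSection_of_uniqueFibreMax
    (F : T3Family) (γ b₀ p₀ : ℝ) (j : ℕ) (hθ : 0 < θBal F.L γ b₀ p₀ (j + 1))
    (r' : GaugeField (F.P (j + 1)) 0 ↥(Matrix.specialUnitaryGroup (Fin 2) ℂ) → ℝ)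
    (hr' : ContinuousOn r' {U | PlaqSmall (θBal F.L γ b₀ p₀ (j + 1)) U})
    (hdc : ContinuousOn (descend F ℰp j : GaugeField (F.P (j + 1)) 0 ↥(Matrix.specialUnitaryGroup (Fin 2) ℂ) →
      GaugeField (F.P j) 0 ↥(Matrix.specialUnitaryGroup (Fin 2) ℂ)) {U | PlaqSmall (θBal F.L γ b₀ p₀ (j + 1)) U})
    (T : PBond (F.P j) 0 → GaugeField (F.P (j + 1)) 0 ↥(Matrix.specialUnitaryGroup (Fin 2) ℂ) → Set ↥(Matrix.specialUnitaryGroup (Fin 2) ℂ))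
    (θ : PBond (F.P j) 0 → GaugeField (F.P (j + 1)) 0 ↥(Matrix.specialUnitaryGroup (Fin 2) ℂ) →
      ↥(Matrix.specialUnitaryGroup (Fin 2) ℂ) → ↥(Matrix.specialUnitaryGroup (Fin 2) ℂ))
    (hTo : ∀ c U, IsOpen (T c U))
    (hθc : ∀ c U, ContinuousOn (θ c U) (T c U))
    (hright : ∀ c U, ∀ v ∈ T c U,
      descend F ℰp j (update U (centralBond (bondShift (sitesPerDir_descend F j 0) c)) (θ c U v)) c = v)
    (hsol : ∀ U : GaugeField (F.P (j + 1)) 0 ↥(Matrix.specialUnitaryGroup (Fin 2) ℂ), PlaqSmall (θBal F.L γ b₀ p₀ (j + 1)) U →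
      ∀ c, descend F ℰp j U c ∈ T c U ∧ θ c U (descend F ℰp j U c) = U (centralBond (bondShift (sitesPerDir_descend F j 0) c)))
    (hmax : ∀ V : GaugeField (F.P j) 0 ↥(Matrix.specialUnitaryGroup (Fin 2) ℂ), PlaqSmall (θBal F.L γ b₀ p₀ j) V →
      ∃ Ustar : GaugeField (F.P (j + 1)) 0 ↥(Matrix.specialUnitaryGroup (Fin 2) ℂ),
        descend F ℰp j Ustar = V ∧ PlaqSmall (θBal F.L γ b₀ p₀ (j + 1) / 2) Ustar ∧
        (∀ U, descend F ℰp j U = V → PlaqSmall (θBal F.L γ b₀ p₀ (j + 1)) U → r' U ≤ r' Ustar) ∧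
        (∀ U, descend F ℰp j U = V → PlaqSmall (θBal F.L γ b₀ p₀ (j + 1)) U → r' Ustar ≤ r' U → U = Ustar)) :
    ∃ Us : GaugeField (F.P j) 0 ↥(Matrix.specialUnitaryGroup (Fin 2) ℂ) → GaugeField (F.P (j + 1)) 0 ↥(Matrix.specialUnitaryGroup (Fin 2) ℂ),
      ContinuousOn Us {V | PlaqSmall (θBal F.L γ b₀ p₀ j) V} ∧
      (∀ V, PlaqSmall (θBal F.L γ b₀ p₀ j) V → descend F ℰp j (Us V) = V ∧ PlaqSmall (θBal F.L γ b₀ p₀ (j + 1) / 2) (Us V) ∧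
        ∀ U, descend F ℰp j U = V → PlaqSmall (θBal F.L γ b₀ p₀ (j + 1)) U → r' U ≤ r' (Us V)) := by
  classical
  set θ' : ℝ := θBal F.L γ b₀ p₀ (j + 1) with hθ'
  set θj : ℝ := θBal F.L γ b₀ p₀ j with hθj
  set β : PBond (F.P j) 0 → PBond (F.P (j + 1)) 0 := fun c => centralBond (bondShift (sitesPerDir_descend F j 0) c) with hβ
  have hβi : Injective β := injective_private F j
  have hloc : IsLocal β (descend F ℰp j : GaugeField (F.P (j + 1)) 0 ↥(Matrix.specialUnitaryGroup (Fin 2) ℂ) →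
      GaugeField (F.P j) 0 ↥(Matrix.specialUnitaryGroup (Fin 2) ℂ)) := isLocal_descend F j
  set O : Set (GaugeField (F.P (j + 1)) 0 ↥(Matrix.specialUnitaryGroup (Fin 2) ℂ)) := {U | PlaqSmall θ' U} with hO
  set K : Set (GaugeField (F.P (j + 1)) 0 ↥(Matrix.specialUnitaryGroup (Fin 2) ℂ)) :=
    {U | ∀ p, dist1 (GaugeField.plaqHol U p) ≤ θ' / 2} with hK
  set W : Set (GaugeField (F.P j) 0 ↥(Matrix.specialUnitaryGroup (Fin 2) ℂ)) := {V | PlaqSmall θj V} with hW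
  have hOopen : IsOpen O := isOpen_setOf_plaqSmall_SU 2 (F.P (j + 1)) 0 θ'
  have hKc : IsClosed K := isClosed_setOf_dist1_le (θ' / 2)
  have hKO : K ⊆ O := fun U hU p => (hU p).trans_lt (by linarith)
  -- the section: choice of the unique maximiser on the window, anything elsewhere
  choose! Ustar hUd hUh hUmax hUuniq using hmax
  refine ⟨Ustar, ?_, fun V hV => ⟨hUd V hV, hUh V hV, hUmax V hV⟩⟩
  -- local continuous sections of `descend` through every small fine field: the triangular chart
  have hlift : ∀ U ∈ O, ∃ Φ : GaugeField (F.P j) 0 ↥(Matrix.specialUnitaryGroup (Fin 2) ℂ) →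
      GaugeField (F.P (j + 1)) 0 ↥(Matrix.specialUnitaryGroup (Fin 2) ℂ),
      ContinuousAt Φ (descend F ℰp j U) ∧ Φ (descend F ℰp j U) = U ∧ ∀ᶠ V' in 𝓝 (descend F ℰp j U), descend F ℰp j (Φ V') = V' := by
    intro U hU
    refine ⟨fun V' => extend β (fun c => θ c U (V' c)) U, ?_, ?_, ?_⟩
    · -- continuity at `descend U`: each `θ c U` is continuous at `descend U c ∈ T c U` (open)
      have hcoord : ∀ c, ContinuousAt (fun V' : GaugeField (F.P j) 0 ↥(Matrix.specialUnitaryGroup (Fin 2) ℂ) => θ c U (V' c))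
          (descend F ℰp j U) := fun c => by
        have hev : Continuous fun V' : GaugeField (F.P j) 0 ↥(Matrix.specialUnitaryGroup (Fin 2) ℂ) => V' c := continuous_apply c
        have h1 : ContinuousAt (θ c U)
            ((fun V' : GaugeField (F.P j) 0 ↥(Matrix.specialUnitaryGroup (Fin 2) ℂ) => V' c) (descend F ℰp j U)) :=
          (hθc c U).continuousAt ((hTo c U).mem_nhds (hsol U hU c).1)
        exact ContinuousAt.comp (f := fun V' : GaugeField (F.P j) 0 ↥(Matrix.specialUnitaryGroup (Fin 2) ℂ) => V' c)
          (x := descend F ℰp j U) h1 hev.continuousAt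
      have hg : ContinuousAt (fun V' : GaugeField (F.P j) 0 ↥(Matrix.specialUnitaryGroup (Fin 2) ℂ) =>
          fun c : PBond (F.P j) 0 => θ c U (V' c)) (descend F ℰp j U) := continuousAt_pi.2 hcoord
      exact (continuous_extend_left hβi U).continuousAt.comp hg
    · -- at `descend U` the chart returns `U` ((SOL): `θ c U (descend U c) = U (β c)`)
      funext i
      show extend β (fun c => θ c U (descend F ℰp j U c)) U i = U i
      by_cases hi : ∃ c, β c = i
      · obtain ⟨c, rfl⟩ := hi
        rw [hβi.extend_apply]
        exact (hsol U hU c).2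
      · exact extend_apply' _ _ _ hi
    · -- on the open set `{V' | ∀ c, V' c ∈ T c U} ∋ descend U` the chart lies over `V'`
      have hopen : IsOpen {V' : GaugeField (F.P j) 0 ↥(Matrix.specialUnitaryGroup (Fin 2) ℂ) | ∀ c, V' c ∈ T c U} := by
        rw [show {V' : GaugeField (F.P j) 0 ↥(Matrix.specialUnitaryGroup (Fin 2) ℂ) | ∀ c, V' c ∈ T c U} =
          ⋂ c, (fun V' => V' c) ⁻¹' T c U from by ext V'; simp]
        exact isOpen_iInter_of_finite fun c => (hTo c U).preimage (continuous_apply c)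
      have hmem : descend F ℰp j U ∈ {V' : GaugeField (F.P j) 0 ↥(Matrix.specialUnitaryGroup (Fin 2) ℂ) | ∀ c, V' c ∈ T c U} :=
        fun c => (hsol U hU c).1
      filter_upwards [hopen.mem_nhds hmem] with V' hV'
      exact T4TriangularFibredChart.apply_triChart_eq_of_forall_mem (β := β) (A := descend F ℰp j) (T := T) (θ := θ) hloc hβi hright hV'
  refine continuousOn_of_unique_fibreMax hOopen hdc hr' hKc hKO hlift Ustar (fun V hV p => (hUh V hV p).le)
    hUd (fun V hV U hU hUO => hUmax V hV U hU hUO) (fun V hV U hU hUO hle => hUuniq V hV U hU hUO hle)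

end Summit.QuantumFields.YangMills.Theorems.OrganTangentModeSectionKnit

end
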